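import Mathlib

/-!
# (A13) of the N5 [A]-ledger, the two parity steps in kernel form

Kernel witnesses (Mathlib only) for the two «elementary parity steps» that route/T5-route-2.md
§N5.13.2 leaves as [A] in item (A13) of §N5.12.6 («`d_v = n(ψ_{δ,v})` is even at every ramified
`v`»), once the conductor formula `d_v = 2 n(ψ_v) + v_E(δ) + d(E_v/F_v)` is taken from print
([FM21] Lemma 3.1, [C] per §N5.13.2) and `d(E_v/F_v) ≡ v_F(D) (mod 2)` from discriminant theory
(prose): for a ramified quadratic `E_v = F_v(√D)` with `e = 2`,

* `v_E(δ) ≡ v_E(√D) (mod 2)` for every anti-invariant `δ = c √D`, `c ∈ F_v^×`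
  (`T5QuadraticInvolution.exists_eq_algebraMap_mul_of_anti` gives the shape `δ = c √D`; here it is the
  hypothesis) — `ord_eq_of_eq_algebraMap_mul`, `ord_sub_ord_even`;
* `v_E(√D) = v_F(D)` (the square root has half the valuation; `v_E = 2 v_F` on `F_v`) —
  `ord_eq_of_sq_eq`;
* the assembly: `d_v = 2 n + v_E(δ) + d` is even whenever `d ≡ v_F(D) (mod 2)` — `even_conductor`.

Valuations are `v : Valuation E ℤᵐ⁰` with `ord x := -log (v x)` (so `v x = exp (-ord x)`), and the
ramification `e = 2` enters only through the hypothesis `v (algebraMap F E c) = exp (-(2 * k))`.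

Uses an L-value-free non-vanishing device: NO (README §8(d)).
-/

namespace Summit.Ventures.HodgeRepro2.T5RamifiedParity

open WithZero

variable {F E : Type*} [Field F] [Field E] [Algebra F E] (v : Valuation E ℤᵐ⁰)

/-- The additive order `ord x = -log (v x)` (junk value `0` at `x = 0`). -/
noncomputable def ord (x : E) : ℤ := -log (v x)

/-- `v x = exp (-ord x)` for `x ≠ 0`. -/
theorem val_eq_exp_neg_ord {x : E} (hx : x ≠ 0) : v x = exp (-ord v x) := by
  rw [ord, neg_neg, exp_log (v.ne_zero_iff.2 hx)]

/-- `ord` is determined by `v x = exp (-k)`. -/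
theorem ord_eq_of_val_eq_exp {x : E} {k : ℤ} (h : v x = exp (-k)) : ord v x = k := by
  rw [ord, h, log_exp, neg_neg]

/-- `ord (x * y) = ord x + ord y` for non-zero `x`, `y`. -/
theorem ord_mul {x y : E} (hx : x ≠ 0) (hy : y ≠ 0) : ord v (x * y) = ord v x + ord v y := by
  simp only [ord, Valuation.map_mul, log_mul (v.ne_zero_iff.2 hx) (v.ne_zero_iff.2 hy), neg_add]

/-- First parity step: if `δ = c s` with `v (algebraMap F E c) = exp (-(2 k))` («`v_E = 2 v_F` on
`F_v`»), then `ord δ = 2 k + ord s`. -/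
theorem ord_eq_of_eq_algebraMap_mul {δ s : E} {c : F} {k : ℤ} (hc : c ≠ 0) (hs : s ≠ 0)
    (hδ : δ = algebraMap F E c * s) (hk : v (algebraMap F E c) = exp (-(2 * k))) :
    ord v δ = 2 * k + ord v s := by
  rw [hδ, ord_mul v ((map_ne_zero _).2 hc) hs, ord_eq_of_val_eq_exp v hk]

/-- `v_E(δ) ≡ v_E(s) (mod 2)` for `δ = c s`, `c ∈ F_v^×` (the anti-invariant elements form the
`F_v`-line through `√D`). -/
theorem ord_sub_ord_even {δ s : E} {c : F} {k : ℤ} (hc : c ≠ 0) (hs : s ≠ 0)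
    (hδ : δ = algebraMap F E c * s) (hk : v (algebraMap F E c) = exp (-(2 * k))) :
    Even (ord v δ - ord v s) := by
  rw [ord_eq_of_eq_algebraMap_mul v hc hs hδ hk]
  exact ⟨k, by ring⟩

/-- Second parity step: a square root has half the valuation — if `s ^ 2 = algebraMap F E D` and
`v (algebraMap F E D) = exp (-(2 * m))` («`v_E(D) = 2 v_F(D)`»), then `ord s = m`
(«`v_E(√D) = v_F(D)`»). -/
theorem ord_eq_of_sq_eq {s : E} {D : F} {m : ℤ} (hs : s ^ 2 = algebraMap F E D)
    (hm : v (algebraMap F E D) = exp (-(2 * m))) : ord v s = m := by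
  have hs0 : s ≠ 0 := by
    rintro rfl
    rw [zero_pow two_ne_zero] at hs
    rw [← hs, map_zero] at hm
    exact exp_ne_zero hm.symm
  have h2 : v s ^ 2 = exp (-(2 * m)) := by rw [← Valuation.map_pow, hs, hm]
  rw [val_eq_exp_neg_ord v hs0, ← exp_nsmul, exp_inj] at h2
  have h3 : (2 : ℤ) * (-ord v s) = -(2 * m) := by simpa [nsmul_eq_mul] using h2
  omega

/-- The assembly of (A13): with `d_v = 2 n + ord δ + d` (the conductor formula, [FM21] Lemma 3.1),
`δ = c √D` (`c ∈ F_v^×`), `(√D)² = D`, `v_E = 2 v_F` on `F_v` and `d ≡ v_F(D) (mod 2)`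
(discriminant theory, prose), `d_v` is even. -/
theorem even_conductor {δ s : E} {c D : F} {k m n d : ℤ} (hc : c ≠ 0)
    (hδ : δ = algebraMap F E c * s) (hk : v (algebraMap F E c) = exp (-(2 * k)))
    (hs : s ^ 2 = algebraMap F E D) (hm : v (algebraMap F E D) = exp (-(2 * m)))
    (hd : Even (d - m)) : Even (2 * n + ord v δ + d) := by
  have hs0 : s ≠ 0 := by
    rintro rfl
    rw [zero_pow two_ne_zero] at hs
    rw [← hs, map_zero] at hm
    exact exp_ne_zero hm.symm
  rw [ord_eq_of_eq_algebraMap_mul v hc hs0 hδ hk, ord_eq_of_sq_eq v hs hm]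
  obtain ⟨j, hj⟩ := hd
  exact ⟨n + k + m + j, by omega⟩

end Summit.Ventures.HodgeRepro2.T5RamifiedParity
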